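import Literature.NumberTheory.Rogawski1990.ArchBouazizClassMultiplier        -- ★ p851490 (this seat, (Σ4a)∕(Σ-MULT)): `exists_archSmooth₂_stOrbFamH_eq_classMul`, `bzClassH`
import Literature.NumberTheory.Rogawski1990.ArchBouazizPositiveTestFunction    -- ★-cand p851507 (this seat, (Σ4b)): `exists_archSmooth₂_stOrbFamH_ne_zero`
import Literature.NumberTheory.Rogawski1990.ArchBouazizSpace                   -- ★ (D2-pack): `ArchBouazizSpaceH` and its projections (P) (W) (I₁)
import HarnessLib

/-!
# (Σ-REG) — LOCAL SURJECTIVITY OF `fH ↦ stOrbFamH L νH fH` AT A BASE CLASS REGULAR AT EVERY PLACE, from its parts: the class-function multiplier (Σ4a), a non-vanishing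
# test function (Σ4b), the chart-type ∕ closed-image geometry of the class map (Σ4d-geo, Σ4-img) and the one-chart descent (Σ4c) (Bouaziz 1994 §5.1; Varadarajan 1989 §6)

Topic `NumberTheory/Rogawski1990`; namespace `Literature.NumberTheory.Rogawski1990`.  THEOREMS ONLY (no `def`, no instance, no notation, no axiom, no named fact, no `sorry`).
Cell `pub/hodgecm-mathlib`, crux H413 (`stmt-HodgeConjecture-24833`), line LH3 (closer stub `stub_N9`, DIRECT ROAD), letter L3′ SURJ-OF-FORWARD road (RULING #22∕#23∕#25, LH3-plan (g4));
binder∕assembler of record LH10-p01 (g5) (★ `bouazizSurjOfForward_of_parts`, p851480, organ binder `hreg`); (Σ-REG) binder F0P3a-p04 (g25), sub-brick **(Σ4d) «ASSEMBLY»**.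
Author F0P3a-p04 (g25).  Count-neutral.

THE ORGAN (★ p851480 `hreg`, at the frame `(L, νH, jcH)`).  `∀ b, (∀ w, (b w).1² ≠ 4·(b w).2.1) → ∃ ε > 0, ∀ Ψ ∈ ArchBouazizSpaceH jcH, ∃ fH ∈ C_c^∞(H_∞),
∀ S c, c ∈ RegS S → dist (bzClassMap S c) b < ε → stOrbFamH L νH fH S c = Ψ S c` — Bouaziz's local surjectivity «dans un bon voisinage de chaque élément semi-simple»
(§5.1 p. 588) at the REGULAR base classes (distinct block eigenvalues at every place), in LOCAL EQUALITY form.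

THE ROAD «CLASS-FUNCTION MULTIPLIER» (LH10-p01 (g5) 2026-09-02T12:38:43Z ∕ 12:47:06Z; carve F0P3a-p04 (g25) 12:57Z).  If `b` is the class of no chart point, a ball around `b`
misses the (closed, (Σ4-img)) class images and `fH := 0` serves.  Otherwise `b = bzClassMap S₀ c₀` with `c₀ ∈ RegS S₀` ((Σ4d-geo) (g1)); near `b` every chart point close in class
is of type `S₀` ((Σ4d-geo) (g3)) with bounded split slots ((Σ4d-geo) (g4)); (Σ4b) ★ `exists_archSmooth₂_stOrbFamH_ne_zero` gives `β ∈ C_c^∞(H_∞)` with `Φ := stOrbFamH L νH β S₀`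
non-vanishing there, and `Φ` carries (P)(W)(I₁) by the FORWARD half (★ p851464, here the hypothesis `hfwd`); the one-chart DESCENT (Σ4c) (LH10-p02 (g7) et al.) turns every
member `Ψ` into a smooth class function `F` with `F(bzClassMap S₀ c) · Φ c = Ψ S₀ c` near `b`; and (Σ4a) ★ `exists_archSmooth₂_stOrbFamH_eq_classMul` (p851490) realises
`(F ∘ bzClassMap S) · stOrbFamH β S` as the stable family of `fH′ = (F ∘ cl_H) · β ∈ C_c^∞(H_∞)` on every regular set.
* §1 `log_norm_add_le_of_mem` — bookkeeping for the split-slot bound.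
* §2 **`bzLocalSurjRegular_of_parts (hreg1) (htype) (hxbd) (himg) (hdesc) (jcH) (hfwd) (b) (hb) : ∃ ε > 0, ∀ Ψ, … = the organ text`** with the five group-free parts as
  HYPOTHESES, texts = the carve of record ((g1) `mem_regS` from non-degenerate class data; (g3) one chart type near a regular class; (g4) `|x_w| ≤ log(‖(b w).1‖ + ε + 1)`;
  (img) `IsClosed (range (bzClassMap S))`; (Σ4c) the based one-chart descent interface of F0P3a-p04 (g25) 12:51:49Z (2)).  The payer by bare names follows in ED. 2 when the
  parts are ★.
HONEST LABEL: L3′ stays XL∕PRINT-labelled ((Σ-WALL) PRINT, RULING #23) until paid; HC_CM is proved only modulo the 7 printed citations (2 remaining: hLiu418 = stmt-HodgeConjecture-24832,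
h413 = stmt-HodgeConjecture-24833) until rung 0 closes; this file is an assembly and pays nothing by itself.

## References
* [Bouaziz1994IntegralesOrbitales] A. Bouaziz, *Intégrales orbitales sur les groupes de Lie réductifs*, Ann. Sci. ÉNS (4) 27 (1994) 573–609, §2.3 p. 578, §5.1 p. 588, Thm. 6.2.1 (i)
  p. 592.
* [Varadarajan1989] V. S. Varadarajan, *An Introduction to Harmonic Analysis on Semisimple Lie Groups*, Cambridge Stud. Adv. Math. 16 (1989), §6.2 (orbital integrals of
  `C_c^∞` functions at regular points).
* [Rogawski1990] J. D. Rogawski, *Automorphic Representations of Unitary Groups in Three Variables*, Ann. of Math. Stud. 123 (1990), §4.1 (4.1.1) p. 39, §8.2 p. 122.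
-/

set_option autoImplicit false

noncomputable section

open MeasureTheory NumberField NumberField.InfinitePlace Complex Set Function Filter Topology
open Literature.NumberTheory.Automorphic Literature.NumberTheory.Automorphic.UnitaryGroup Literature.NumberTheory.Automorphic.ArchCartan
open scoped Classical ContDiff

namespace Literature.NumberTheory.Rogawski1990

/-! ## §1 Bookkeeping -/

/-- `log(‖t_w‖ + ε + 1) ≤ log((∑_w ‖t_w‖) + ε + 1)` for `ε ≥ 0`. [cite: Bouaziz1994IntegralesOrbitales, §2.3 p. 578] -/
theorem log_norm_add_le_of_mem {W : Type*} [Fintype W] (b : W → ℂ × ℂ × ℂ) {ε : ℝ} (hε : 0 ≤ ε) (w : W) :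
    Real.log (‖(b w).1‖ + ε + 1) ≤ Real.log ((∑ w', ‖(b w').1‖) + ε + 1) := by
  have h1 : ‖(b w).1‖ ≤ ∑ w', ‖(b w').1‖ := Finset.single_le_sum (f := fun w' => ‖(b w').1‖) (fun w' _ => norm_nonneg _) (Finset.mem_univ w)
  exact Real.log_le_log (by positivity) (by linarith)

/-! ## §2 The assembly -/

section Assembly

variable (L : Type) [Field L] [NumberField L] [IsCMField L]
  [MeasurableSpace (↥(arch (↥(maximalRealSubfield L)) L (IsCMField.complexConj L) 2 (Matrix.of fun i j : Fin 2 => if i.val + j.val + 1 = 2 then (1 : L) else 0)) ×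
      ↥(arch (↥(maximalRealSubfield L)) L (IsCMField.complexConj L) 1 (Matrix.of fun i j : Fin 1 => if i.val + j.val + 1 = 1 then (1 : L) else 0)))]
  [BorelSpace (↥(arch (↥(maximalRealSubfield L)) L (IsCMField.complexConj L) 2 (Matrix.of fun i j : Fin 2 => if i.val + j.val + 1 = 2 then (1 : L) else 0)) ×
      ↥(arch (↥(maximalRealSubfield L)) L (IsCMField.complexConj L) 1 (Matrix.of fun i j : Fin 1 => if i.val + j.val + 1 = 1 then (1 : L) else 0)))]
  (νH : Measure (↥(arch (↥(maximalRealSubfield L)) L (IsCMField.complexConj L) 2 (Matrix.of fun i j : Fin 2 => if i.val + j.val + 1 = 2 then (1 : L) else 0)) ×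
      ↥(arch (↥(maximalRealSubfield L)) L (IsCMField.complexConj L) 1 (Matrix.of fun i j : Fin 1 => if i.val + j.val + 1 = 1 then (1 : L) else 0))))
  [νH.IsHaarMeasure] [νH.IsMulRightInvariant]

/-- **(Σ-REG) FROM ITS PARTS** — the `hreg` organ of ★ `bouazizSurjOfForward_of_parts` (p851480) at the frame `(L, νH, jcH)`, from: (g1) non-degenerate class data ⇒ regular
chart point; (g3) ONE chart type near a regular class; (g4) bounded split slots near a class; (img) closed class images; (Σ4c) the based one-chart descent (smooth class
function `F` with `F(bzClassMap S c) · Φ c = Ψ c` near a regular chart point, for every `Ψ` with the chart-`S` rules (P)(W)(X)(I₁), given ONE such `Φ` non-vanishing there) —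
and IN HOUSE: (Σ4b) ★ `exists_archSmooth₂_stOrbFamH_ne_zero` (the `Φ`), the forward membership `hfwd` (its (P)(W)(I₁)), (Σ4a) ★ `exists_archSmooth₂_stOrbFamH_eq_classMul`
(the test function `(F ∘ cl_H) · β`). [cite: Bouaziz1994IntegralesOrbitales, §5.1 p. 588; Thm. 6.2.1 (i) p. 592] [cite: Varadarajan1989, §6.2] -/
theorem bzLocalSurjRegular_of_parts
    -- (g1) regular chart points from non-degenerate class data
    (hreg1 : ∀ (S : Finset {w : InfinitePlace L // IsComplex w}) (c : {w : InfinitePlace L // IsComplex w} → Fin 3 → ℝ),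
      (∀ w, (bzClassMap S c w).1 ^ 2 ≠ 4 * (bzClassMap S c w).2.1) → c ∈ RegS S)
    -- (g3) near a regular class there is ONE chart type
    (htype : ∀ b : {w : InfinitePlace L // IsComplex w} → ℂ × ℂ × ℂ, (∀ w, (b w).1 ^ 2 ≠ 4 * (b w).2.1) → ∃ ε : ℝ, 0 < ε ∧
      ∀ (S S' : Finset {w : InfinitePlace L // IsComplex w}) (c c' : {w : InfinitePlace L // IsComplex w} → Fin 3 → ℝ),
        dist (bzClassMap S c) b < ε → dist (bzClassMap S' c') b < ε → S = S')
    -- (g4) bounded split slots near a class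
    (hxbd : ∀ (S : Finset {w : InfinitePlace L // IsComplex w}) (c : {w : InfinitePlace L // IsComplex w} → Fin 3 → ℝ)
      (b : {w : InfinitePlace L // IsComplex w} → ℂ × ℂ × ℂ) (ε : ℝ) (w : {w : InfinitePlace L // IsComplex w}),
        w ∈ S → dist (bzClassMap S c) b < ε → |c w 0| ≤ Real.log (‖(b w).1‖ + ε + 1))
    -- (img) the class image of every chart is closed
    (himg : ∀ S : Finset {w : InfinitePlace L // IsComplex w}, IsClosed (Set.range (bzClassMap S)))
    -- (Σ4c) the based one-chart descent
    (hdesc : ∀ (S : Finset {w : InfinitePlace L // IsComplex w}) {c₀ : {w : InfinitePlace L // IsComplex w} → Fin 3 → ℝ}, c₀ ∈ RegS S →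
      ∀ (Φ : ({w : InfinitePlace L // IsComplex w} → Fin 3 → ℝ) → ℂ) {ε₀ : ℝ}, 0 < ε₀ →
        (∀ (c : {w : InfinitePlace L // IsComplex w} → Fin 3 → ℝ) (w : {w : InfinitePlace L // IsComplex w}) (i : Fin 3) (k : ℤ),
          (w ∉ S ∨ i ≠ 0) → Φ (c + angleShift w i k) = Φ c) →
        (∀ (c : {w : InfinitePlace L // IsComplex w} → Fin 3 → ℝ) (w : {w : InfinitePlace L // IsComplex w}), w ∉ S → Φ (flipAt w c) * archRH S c = archRH S (flipAt w c) * Φ c) →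
        (∀ (c : {w : InfinitePlace L // IsComplex w} → Fin 3 → ℝ) (w : {w : InfinitePlace L // IsComplex w}), w ∈ S → Φ (negXAt w c) = Φ c) →
        ContDiffOn ℝ ∞ Φ (InRegS S) →
        (∀ c ∈ RegS S, dist (bzClassMap S c) (bzClassMap S c₀) < ε₀ → Φ c ≠ 0) →
        ∃ ε : ℝ, 0 < ε ∧ ε ≤ ε₀ ∧ ∀ Ψ : ({w : InfinitePlace L // IsComplex w} → Fin 3 → ℝ) → ℂ,
          (∀ (c : {w : InfinitePlace L // IsComplex w} → Fin 3 → ℝ) (w : {w : InfinitePlace L // IsComplex w}) (i : Fin 3) (k : ℤ),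
            (w ∉ S ∨ i ≠ 0) → Ψ (c + angleShift w i k) = Ψ c) →
          (∀ (c : {w : InfinitePlace L // IsComplex w} → Fin 3 → ℝ) (w : {w : InfinitePlace L // IsComplex w}), w ∉ S → Ψ (flipAt w c) * archRH S c = archRH S (flipAt w c) * Ψ c) →
          (∀ (c : {w : InfinitePlace L // IsComplex w} → Fin 3 → ℝ) (w : {w : InfinitePlace L // IsComplex w}), w ∈ S → Ψ (negXAt w c) = Ψ c) →
          ContDiffOn ℝ ∞ Ψ (InRegS S) →
          ∃ F : ({w : InfinitePlace L // IsComplex w} → ℂ × ℂ × ℂ) → ℂ, ContDiff ℝ ∞ F ∧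
            ∀ c ∈ RegS S, dist (bzClassMap S c) (bzClassMap S c₀) < ε → F (bzClassMap S c) * Φ c = Ψ c)
    -- the frame datum and the FORWARD half
    (jcH : Finset {w : InfinitePlace L // IsComplex w} → {w : InfinitePlace L // IsComplex w} → ℂ)
    (hfwd : ∀ fH : ↥(arch (↥(maximalRealSubfield L)) L (IsCMField.complexConj L) 2 (Matrix.of fun i j : Fin 2 => if i.val + j.val + 1 = 2 then (1 : L) else 0)) ×
        ↥(arch (↥(maximalRealSubfield L)) L (IsCMField.complexConj L) 1 (Matrix.of fun i j : Fin 1 => if i.val + j.val + 1 = 1 then (1 : L) else 0)) → ℂ,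
      ArchSmooth₂ L fH → ArchBouazizSpaceH jcH (stOrbFamH L νH fH))
    (b : {w : InfinitePlace L // IsComplex w} → ℂ × ℂ × ℂ) (hb : ∀ w, (b w).1 ^ 2 ≠ 4 * (b w).2.1) :
    ∃ ε : ℝ, 0 < ε ∧
      ∀ Ψ : Finset {w : InfinitePlace L // IsComplex w} → ({w : InfinitePlace L // IsComplex w} → Fin 3 → ℝ) → ℂ, ArchBouazizSpaceH jcH Ψ →
        ∃ fH : ↥(arch (↥(maximalRealSubfield L)) L (IsCMField.complexConj L) 2 (Matrix.of fun i j : Fin 2 => if i.val + j.val + 1 = 2 then (1 : L) else 0)) ×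
            ↥(arch (↥(maximalRealSubfield L)) L (IsCMField.complexConj L) 1 (Matrix.of fun i j : Fin 1 => if i.val + j.val + 1 = 1 then (1 : L) else 0)) → ℂ,
          ArchSmooth₂ L fH ∧ ∀ (S : Finset {w : InfinitePlace L // IsComplex w}) (c : {w : InfinitePlace L // IsComplex w} → Fin 3 → ℝ),
            c ∈ RegS S → dist (bzClassMap S c) b < ε → stOrbFamH L νH fH S c = Ψ S c := by
  by_cases hex : ∃ (S₀ : Finset {w : InfinitePlace L // IsComplex w}) (c₀ : {w : InfinitePlace L // IsComplex w} → Fin 3 → ℝ), bzClassMap S₀ c₀ = b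
  · -- `b` IS the class of a (regular) chart point `c₀` of type `S₀`
    obtain ⟨S₀, c₀, hc₀b⟩ := hex
    have hc₀ : c₀ ∈ RegS S₀ := hreg1 S₀ c₀ fun w => by rw [hc₀b]; exact hb w
    obtain ⟨ε₂, hε₂, htyp⟩ := htype b hb
    -- one bound for the split slots at class-distance `< 1`
    obtain ⟨R, hR⟩ : ∃ R : ℝ, R = Real.log ((∑ w, ‖(b w).1‖) + 1 + 1) := ⟨_, rfl⟩
    have hRbd : ∀ (c : {w : InfinitePlace L // IsComplex w} → Fin 3 → ℝ), dist (bzClassMap S₀ c) b < 1 → ∀ w, w ∈ S₀ → |c w 0| ≤ R := fun c hd w hw => by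
      rw [hR]
      exact (hxbd S₀ c b 1 w hw hd).trans (log_norm_add_le_of_mem b zero_le_one w)
    -- (Σ4b): the non-vanishing `Φ = stOrbFamH L νH β S₀`
    obtain ⟨β, hβ, hβne⟩ := exists_archSmooth₂_stOrbFamH_ne_zero L νH S₀ R
    have hΦ := hfwd β hβ
    have hΦ0 : ∀ c ∈ RegS S₀, dist (bzClassMap S₀ c) (bzClassMap S₀ c₀) < 1 → stOrbFamH L νH β S₀ c ≠ 0 := fun c hc hd =>
      hβne c hc (hRbd c (by rwa [hc₀b] at hd))
    -- (Σ4c): the radius and the descent at `(S₀, c₀, Φ)`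
    obtain ⟨ε, hε, hε1, hF⟩ := hdesc S₀ hc₀ (stOrbFamH L νH β S₀) one_pos (fun c w i k h => hΦ.periodic S₀ c w i k h)
      (fun c w hw => hΦ.weyl.1 S₀ c w hw) (fun c w hw => hΦ.weyl.2 S₀ c w hw) (hΦ.smoothBounded S₀).1 hΦ0
    refine ⟨min ε ε₂, lt_min hε hε₂, fun Ψ hΨ => ?_⟩
    obtain ⟨F, hFs, hFid⟩ := hF (Ψ S₀) (fun c w i k h => hΨ.periodic S₀ c w i k h) (fun c w hw => hΨ.weyl.1 S₀ c w hw) (fun c w hw => hΨ.weyl.2 S₀ c w hw)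
      (hΨ.smoothBounded S₀).1
    -- (Σ4a): the test function `(F ∘ cl_H) · β`
    obtain ⟨fH', hfH', hmul⟩ := exists_archSmooth₂_stOrbFamH_eq_classMul L νH F hFs β hβ
    refine ⟨fH', hfH', fun S c hc hd => ?_⟩
    have hS : S = S₀ := htyp S S₀ c c₀ (hd.trans_le (min_le_right _ _)) (by rw [hc₀b, dist_self]; exact hε₂)
    subst hS
    rw [hmul S c hc]
    exact hFid c hc (by rw [hc₀b]; exact hd.trans_le (min_le_left _ _))
  · -- `b` is the class of NO chart point: a ball around `b` misses every (closed) class image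
    push Not at hex
    have hfar : ∀ S : Finset {w : InfinitePlace L // IsComplex w}, ∃ ε : ℝ, 0 < ε ∧ ∀ c, ε ≤ dist (bzClassMap S c) b := fun S => by
      have hb' : b ∈ (Set.range (bzClassMap S))ᶜ := fun ⟨c, hc⟩ => hex S c hc
      obtain ⟨ε, hε, hball⟩ := Metric.isOpen_iff.1 (himg S).isOpen_compl b hb'
      exact ⟨ε, hε, fun c => not_lt.1 fun h => hball (Metric.mem_ball.2 h) ⟨c, rfl⟩⟩
    choose ε hε hεfar using hfar
    refine ⟨Finset.univ.inf' ⟨∅, Finset.mem_univ _⟩ ε, (Finset.lt_inf'_iff _).2 fun S _ => hε S, fun Ψ _ => ⟨0, archSmooth₂_zero L, fun S c _ hd => ?_⟩⟩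
    exact absurd hd (not_lt.2 ((Finset.inf'_le _ (Finset.mem_univ S)).trans (hεfar S c)))

end Assembly

end Literature.NumberTheory.Rogawski1990

end
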